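import Mathlib
import Summits.PneNP.PneNP.Theorems.ClusUniversalCertificateCoordZeroFree
import Summits.PneNP.PneNP.Theorems.ClusUniversalCertificateLayerUCLeTwo

/-!
# Route ClusUniversalCertificate — path `coord` on the crux `UniversalCertAll` (stmt-PneNP-19683): COLUMN DOMINATION, mixed blocks
(rung F-N1, cell pnp-ideate; helper for the registered stub `stub_baseTwoBlocks` of skeleton v11 sha16 e5cba65d, which lives in
`ClusUniversalCertificateCoordBaseTwoBlocks.lean`)

Helper lemmas on the objects of `ClusUniversalCertificateCoordDefs.lean` (p516754), mixed-size version of line card §UC2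
(= `ClusLayer.stub_ucLeTwo`, p513574, whose coset lemma `ClusLayer.card_le_of_cosets` is imported):
* certificate codimension `0`/`1` on `𝔽₂^M` (`one_le_acodim`, `acodim_univ`, `exists_functional_of_acodim_eq_one`: a point of
  codimension `1` in `Y ≠ univ` lies on an affine hyperplane inside `Y`);
* **column domination** on an abstract product `V₁ × V₂` of finite `𝔽₂`-spaces (`card_le_of_hyperplanes`): a set `U` of points each
  on an affine hyperplane inside `Y` has `|U| ≤ |V₂|·#{y ∈ Y : y.2 = 0} + |V₁|·#{y ∈ Y : y.1 = 0}` — columns `a` with `(a, 0) ∈ Y`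
  are counted by the first term (`≤ |V₂|` points each), a column with `(a, 0) ∉ Y` is dominated by the column of `Y` over `0`
  (coset lemma), and there are `≤ |V₁|` of those;
* the count `2^{bsize j}·Z_j(univ) = 2^M` for every block (`two_pow_bsize_mul_zcount_univ`) and the certificate for `Y = univ`,
  an EQUALITY for every block map (`ucMix_univ`).

HONEST FRAMING: helper lemmas (finite linear algebra / counting over `𝔽₂`) for ONE M-sized registered stub of an OPEN crux of route
ClusUniversalCertificate; the load-bearing stub `stub_peelZeroRare3` is OPEN and XL; FRONTIER rung F-N1 — nothing here bears on
P vs NP.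
-/

set_option linter.dupNamespace false -- `Summit.PneNP.PneNP.…`: summit = sub-problem name (D-0017 single-conjunct layout)
namespace Summit.PneNP.PneNP.Theorems.ClusCoordTwoBlocks

open Finset
open Summit.PneNP.PneNP.Theorems.ClusCoord (acodim bsize zcount UCMix)
open Summit.PneNP.PneNP.Theorems.ClusCoordZeroFree (sum_bsize_eq zcount_of_bsize_eq_zero)
open Summit.PneNP.PneNP.Theorems.ClusLayer (card_le_of_cosets)

variable {M n : ℕ}

/-! ## Flats inside `Y ⊆ 𝔽₂^M`: certificate codimension `0` and `1` -/

/-- `dim 𝔽₂^M = M`. -/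
theorem finrank_fun (M : ℕ) : Module.finrank (ZMod 2) (Fin M → ZMod 2) = M := by
  simp

/-- The set in the definition of `acodim` is nonempty for `y ∈ Y` (the singleton flat `{y}`). -/
theorem acodim_set_nonempty (Y : Finset (Fin M → ZMod 2)) {y : Fin M → ZMod 2} (hy : y ∈ Y) :
    {c : ℕ | ∃ A : AffineSubspace (ZMod 2) (Fin M → ZMod 2), y ∈ A ∧ (∀ z ∈ A, z ∈ Y) ∧
      M ≤ Module.finrank (ZMod 2) A.direction + c}.Nonempty := by
  refine ⟨M, affineSpan (ZMod 2) {y}, mem_affineSpan (ZMod 2) (Set.mem_singleton y), ?_, Nat.le_add_left _ _⟩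
  intro z hz
  rw [AffineSubspace.mem_affineSpan_singleton] at hz
  rw [hz]; exact hy

/-- A flat inside `Y` with direction `⊤` forces `Y = univ`. -/
theorem eq_univ_of_direction_eq_top {Y : Finset (Fin M → ZMod 2)}
    {A : AffineSubspace (ZMod 2) (Fin M → ZMod 2)} {y : Fin M → ZMod 2} (hyA : y ∈ A)
    (hAY : ∀ z ∈ A, z ∈ Y) (hD : A.direction = ⊤) : Y = univ := by
  have hA : A = ⊤ := (AffineSubspace.direction_eq_top_iff_of_nonempty ⟨y, hyA⟩).mp hD
  exact eq_univ_iff_forall.mpr fun z => hAY z (hA ▸ AffineSubspace.mem_top (ZMod 2) _ z)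

/-- If `Y ≠ univ`, every point of `Y` has certificate codimension at least `1`. -/
theorem one_le_acodim {Y : Finset (Fin M → ZMod 2)} (hY : Y ≠ univ)
    {y : Fin M → ZMod 2} (hy : y ∈ Y) : 1 ≤ acodim M Y y := by
  rw [Nat.one_le_iff_ne_zero]
  intro h0
  obtain ⟨A, hyA, hAY, hc⟩ := Nat.sInf_mem (acodim_set_nonempty Y hy)
  have hc' : M ≤ Module.finrank (ZMod 2) A.direction := by
    have : acodim M Y y = 0 := h0
    unfold acodim at this
    rw [this, add_zero] at hc
    exact hc
  have hD : A.direction = ⊤ :=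
    Submodule.eq_top_of_finrank_eq (le_antisymm (Submodule.finrank_le _) (by rw [finrank_fun]; exact hc'))
  exact hY (eq_univ_of_direction_eq_top hyA hAY hD)

/-- For `Y = univ` every certificate codimension is `0` (the whole space is a flat inside `Y`). -/
theorem acodim_univ (y : Fin M → ZMod 2) : acodim M univ y = 0 := by
  apply Nat.eq_zero_of_le_zero
  unfold acodim
  apply Nat.sInf_le
  refine ⟨⊤, AffineSubspace.mem_top (ZMod 2) _ y, fun z _ => mem_univ z, ?_⟩
  rw [AffineSubspace.direction_top, finrank_top, finrank_fun]
  omega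

/-- A point of certificate codimension `1` in `Y ≠ univ` lies on an affine hyperplane inside `Y`: there is a linear
functional `f` with `{x : f x = f y} ⊆ Y`. -/
theorem exists_functional_of_acodim_eq_one {Y : Finset (Fin M → ZMod 2)} (hY : Y ≠ univ)
    {y : Fin M → ZMod 2} (hy : y ∈ Y) (h1 : acodim M Y y = 1) :
    ∃ f : (Fin M → ZMod 2) →ₗ[ZMod 2] ZMod 2, ∀ x, f x = f y → x ∈ Y := by
  obtain ⟨A, hyA, hAY, hc⟩ := Nat.sInf_mem (acodim_set_nonempty Y hy)
  have hc' : M ≤ Module.finrank (ZMod 2) A.direction + 1 := by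
    unfold acodim at h1
    rw [h1] at hc
    exact hc
  have hDtop : A.direction ≠ ⊤ := fun hD => hY (eq_univ_of_direction_eq_top hyA hAY hD)
  obtain ⟨f, hf0, hDf⟩ := Submodule.exists_le_ker_of_lt_top _ (lt_top_iff_ne_top.mpr hDtop)
  have hker : LinearMap.ker f ≠ ⊤ := by rwa [Ne, LinearMap.ker_eq_top]
  have hlt := Submodule.finrank_lt hker
  rw [finrank_fun] at hlt
  have hDeq : A.direction = LinearMap.ker f := Submodule.eq_of_le_of_finrank_le hDf (by omega)
  refine ⟨f, fun x hx => hAY x ?_⟩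
  have hmem : x -ᵥ y ∈ A.direction := by
    rw [hDeq, LinearMap.mem_ker, vsub_eq_sub, map_sub, hx, sub_self]
  exact (AffineSubspace.vsub_right_mem_direction_iff_mem hyA x).mp hmem

/-! ## Column domination on a product of two finite `𝔽₂`-spaces -/

/-- **Column domination** (line card §UC2, abstract form).  In `V₁ × V₂`, a set `U` of points each lying on an affine hyperplane
inside `Y` has `|U| ≤ |V₂|·#{y ∈ Y : y.2 = 0} + |V₁|·#{y ∈ Y : y.1 = 0}`: the columns `a` with `(a, 0) ∈ Y` are counted by the first
term, and a column with `(a, 0) ∉ Y` is dominated by the column of `Y` over `0` (coset lemma). -/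
theorem card_le_of_hyperplanes {V₁ V₂ : Type*} [AddCommGroup V₁] [Module (ZMod 2) V₁] [Fintype V₁] [DecidableEq V₁]
    [AddCommGroup V₂] [Module (ZMod 2) V₂] [Fintype V₂] [DecidableEq V₂]
    (Y U : Finset (V₁ × V₂))
    (hU : ∀ u ∈ U, ∃ f : (V₁ × V₂) →ₗ[ZMod 2] ZMod 2, ∀ x, f x = f u → x ∈ Y) :
    U.card ≤ Fintype.card V₂ * (Y.filter fun y => y.2 = 0).card +
      Fintype.card V₁ * (Y.filter fun y => y.1 = 0).card := by
  classical
  -- split `U` into columns `y.1 = a`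
  have hfib : U.card = ∑ a : V₁, (U.filter fun y => y.1 = a).card :=
    card_eq_sum_card_fiberwise (f := fun y : V₁ × V₂ => y.1) (t := univ)
      fun _ _ => mem_coe.mpr (mem_univ _)
  have hinj : ∀ a : V₁, Set.InjOn (fun y : V₁ × V₂ => y.2) ↑(U.filter fun y => y.1 = a) := by
    intro a y hy y' hy' h
    have e := (mem_filter.mp (mem_coe.mp hy)).2
    have e' := (mem_filter.mp (mem_coe.mp hy')).2
    exact Prod.ext (e.trans e'.symm) h
  -- every column has at most `|V₂|` points
  have hcol : ∀ a : V₁, (U.filter fun y => y.1 = a).card ≤ Fintype.card V₂ := by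
    intro a
    rw [← card_univ]
    exact card_le_card_of_injOn (fun y => y.2) (fun _ _ => mem_coe.mpr (mem_univ _)) (hinj a)
  -- a column with `(a, 0) ∉ Y` is dominated by the column of `Y` over `0`
  have hdom : ∀ a : V₁, (a, (0 : V₂)) ∉ Y →
      (U.filter fun y => y.1 = a).card ≤ (Y.filter fun y => y.1 = 0).card := by
    intro a ha
    set Ua := (U.filter fun y => y.1 = a).image fun y => y.2 with hUa_def
    set Y0 := (Y.filter fun y => y.1 = 0).image fun y => y.2 with hY0_def
    have hUa : (U.filter fun y => y.1 = a).card = Ua.card := (card_image_of_injOn (hinj a)).symm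
    have hY0 : Y0.card ≤ (Y.filter fun y => y.1 = 0).card := card_image_le
    have key : ∀ b ∈ Ua, ∃ φ : V₂ →ₗ[ZMod 2] ZMod 2, ∃ c : ZMod 2,
        φ b = 1 ∧ ∀ v, φ v = c → v ∈ Y0 := by
      intro b hb
      obtain ⟨u, hu, hub⟩ := mem_image.mp hb
      obtain ⟨huU, hua⟩ := mem_filter.mp hu
      obtain ⟨f, hf⟩ := hU u huU
      -- `f (a', v) = f (a', 0) + f (0, v)`
      have hsplit : ∀ a' : V₁, ∀ v : V₂, f (a', v) = f (a', 0) + f (0, v) := by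
        intro a' v
        rw [← map_add, Prod.mk_add_mk, add_zero, zero_add]
      have hu_eq : u = (a, b) := Prod.ext hua hub
      refine ⟨f.comp (LinearMap.inr (ZMod 2) V₁ V₂), f u, ?_, ?_⟩
      · -- the hyperplane's column at `a` misses `0`, so `φ b = 1`
        rw [LinearMap.comp_apply, LinearMap.inr_apply]
        by_contra hne
        have h0 : f (0, b) = 0 := by
          generalize f (0, b) = x at hne
          revert hne x; decide
        apply ha
        apply hf
        rw [hu_eq, hsplit a b, h0, add_zero]
      · -- the hyperplane's column at `0` lies in `Y0`
        intro v hv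
        rw [LinearMap.comp_apply, LinearMap.inr_apply] at hv
        exact mem_image.mpr ⟨(0, v), mem_filter.mpr ⟨hf _ hv, rfl⟩, rfl⟩
    choose! Φ C hΦ using key
    rw [hUa]
    exact (card_le_of_cosets Ua Y0 Φ C hΦ).trans hY0
  -- the columns containing `(a, 0)` are counted by `#{y ∈ Y : y.2 = 0}`
  have hZ : ((univ : Finset V₁).filter fun a => (a, (0 : V₂)) ∈ Y).card = (Y.filter fun y => y.2 = 0).card := by
    apply card_nbij' (fun a => (a, (0 : V₂))) (fun y => y.1)
    · intro a ha
      have h := (mem_filter.mp (mem_coe.mp ha)).2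
      exact mem_coe.mpr (mem_filter.mpr ⟨h, rfl⟩)
    · intro y hy
      obtain ⟨hyY, hy2⟩ := mem_filter.mp (mem_coe.mp hy)
      refine mem_coe.mpr (mem_filter.mpr ⟨mem_univ _, ?_⟩)
      have e : (y.1, (0 : V₂)) = y := Prod.ext rfl hy2.symm
      rw [e]; exact hyY
    · intro a _; rfl
    · intro y hy
      obtain ⟨_, hy2⟩ := mem_filter.mp (mem_coe.mp hy)
      exact Prod.ext rfl hy2.symm
  -- add up
  rw [hfib, ← sum_filter_add_sum_filter_not univ (fun a => (a, (0 : V₂)) ∈ Y)]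
  have h1 : ∑ a ∈ univ.filter (fun a => (a, (0 : V₂)) ∈ Y), (U.filter fun y => y.1 = a).card ≤
      Fintype.card V₂ * (Y.filter fun y => y.2 = 0).card := by
    calc ∑ a ∈ univ.filter (fun a => (a, (0 : V₂)) ∈ Y), (U.filter fun y => y.1 = a).card
        ≤ (univ.filter (fun a => (a, (0 : V₂)) ∈ Y)).card • Fintype.card V₂ :=
          sum_le_card_nsmul _ _ _ fun a _ => hcol a
      _ = Fintype.card V₂ * (Y.filter fun y => y.2 = 0).card := by rw [hZ, smul_eq_mul, mul_comm]
  have h2 : ∑ a ∈ univ.filter (fun a => ¬ (a, (0 : V₂)) ∈ Y), (U.filter fun y => y.1 = a).card ≤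
      Fintype.card V₁ * (Y.filter fun y => y.1 = 0).card := by
    calc ∑ a ∈ univ.filter (fun a => ¬ (a, (0 : V₂)) ∈ Y), (U.filter fun y => y.1 = a).card
        ≤ (univ.filter (fun a => ¬ (a, (0 : V₂)) ∈ Y)).card • (Y.filter fun y => y.1 = 0).card :=
          sum_le_card_nsmul _ _ _ fun a ha => hdom a (mem_filter.mp ha).2
      _ ≤ (univ : Finset V₁).card • (Y.filter fun y => y.1 = 0).card := by
          rw [smul_eq_mul, smul_eq_mul]
          exact Nat.mul_le_mul_right _ (card_filter_le _ _)
      _ = Fintype.card V₁ * (Y.filter fun y => y.1 = 0).card := by rw [card_univ, smul_eq_mul]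
  omega

/-! ## The two blocks as a product, and the count for `Y = univ` -/

/-- The functions on the coordinates of block `j` number `2^{bsize j}`. -/
theorem card_blockFun (blk : Fin M → Fin n) (j : Fin n) :
    Fintype.card ({i : Fin M // blk i = j} → ZMod 2) = 2 ^ bsize blk j := by
  rw [Fintype.card_fun, ZMod.card, Fintype.card_subtype]
  rfl

/-- `2^{bsize j} · Z_j(univ) = 2^M` for every block `j`: the points whose block `j` vanishes are the functions on the other
coordinates. -/
theorem two_pow_bsize_mul_zcount_univ (blk : Fin M → Fin n) (j : Fin n) :
    2 ^ bsize blk j * zcount blk j (univ : Finset (Fin M → ZMod 2)) = 2 ^ M := by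
  classical
  have hz : zcount blk j (univ : Finset (Fin M → ZMod 2)) =
      Fintype.card {y : Fin M → ZMod 2 // ∀ i, blk i = j → y i = 0} := by
    unfold zcount
    rw [Fintype.card_subtype]
  have he : Fintype.card {y : Fin M → ZMod 2 // ∀ i, blk i = j → y i = 0} =
      Fintype.card ({i : Fin M // ¬ blk i = j} → ZMod 2) := by
    refine Fintype.card_congr
      { toFun := fun y i => y.1 i.1
        invFun := fun g => ⟨fun i => if h : blk i = j then 0 else g ⟨i, h⟩, fun i hi => by simp [hi]⟩
        left_inv := ?_
        right_inv := ?_ }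
    · intro y
      apply Subtype.ext
      funext i
      by_cases h : blk i = j
      · simp only [dif_pos h]
        exact (y.2 i h).symm
      · simp only [dif_neg h]
    · intro g
      funext i
      simp only [dif_neg i.2]
  have hc : Fintype.card ({i : Fin M // ¬ blk i = j} → ZMod 2) = 2 ^ (M - bsize blk j) := by
    rw [Fintype.card_fun, ZMod.card, Fintype.card_subtype_compl, Fintype.card_fin, Fintype.card_subtype]
    rfl
  have hle : bsize blk j ≤ M := by
    unfold bsize
    exact (card_filter_le _ _).trans (by simp)
  rw [hz, he, hc, ← pow_add, Nat.add_sub_cancel' hle]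

/-- `Σ_j (bsize j − 1) = M − n` (as integers). -/
theorem sum_bsize_sub_one (blk : Fin M → Fin n) : ∑ j : Fin n, ((bsize blk j : ℤ) - 1) = (M : ℤ) - n := by
  rw [sum_sub_distrib, sum_const, card_univ, Fintype.card_fin, nsmul_eq_mul, mul_one]
  have h' : ∑ j : Fin n, (bsize blk j : ℤ) = (M : ℤ) := by exact_mod_cast sum_bsize_eq blk
  rw [h']

/-- The mixed certificate for `Y = univ` is an EQUALITY, for every block map. -/
theorem ucMix_univ (blk : Fin M → Fin n) : UCMix M n blk (univ : Finset (Fin M → ZMod 2)) := by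
  unfold UCMix
  have h : ∀ j : Fin n, (2 : ℤ) ^ bsize blk j * (zcount blk j (univ : Finset (Fin M → ZMod 2)) : ℤ) = (2 : ℤ) ^ M := by
    intro j; exact_mod_cast two_pow_bsize_mul_zcount_univ blk j
  have hcardU : (((univ : Finset (Fin M → ZMod 2)).card : ℕ) : ℤ) = (2 : ℤ) ^ M := by
    rw [card_univ, Fintype.card_fun, ZMod.card, Fintype.card_fin]; push_cast; rfl
  have hsumb := sum_bsize_sub_one blk
  apply le_of_eq
  calc ∑ y ∈ (univ : Finset (Fin M → ZMod 2)),
        (((M : ℤ) - (acodim M univ y : ℤ)) - ∑ j : Fin n, ((bsize blk j : ℤ) - 1))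
      = ∑ _y ∈ (univ : Finset (Fin M → ZMod 2)), (n : ℤ) :=
        sum_congr rfl fun y _ => by rw [acodim_univ, hsumb]; push_cast; ring
    _ = (n : ℤ) * (2 : ℤ) ^ M := by rw [sum_const, nsmul_eq_mul, hcardU, mul_comm]
    _ = ∑ _j : Fin n, (2 : ℤ) ^ M := by rw [sum_const, card_univ, Fintype.card_fin, nsmul_eq_mul]
    _ = ∑ j : Fin n, (2 : ℤ) ^ bsize blk j * (zcount blk j (univ : Finset (Fin M → ZMod 2)) : ℤ) :=
        sum_congr rfl fun j _ => (h j).symm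

end Summit.PneNP.PneNP.Theorems.ClusCoordTwoBlocks
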